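import Mathlib
import Literature.MathematicalPhysics.QuantumFieldTheory.BalabanImbrieJaffe1984to88.BIJ85Sect4Statements
import Literature.MathematicalPhysics.QuantumFieldTheory.BalabanImbrieJaffe1984to88.BIJ85Prop511Torus
import Literature.MathematicalPhysics.QuantumFieldTheory.BalabanImbrieJaffe1984to88.BIJ85Eq531Inputs
import Literature.MathematicalPhysics.QuantumFieldTheory.BalabanImbrieJaffe1984to88.BIJ85Sigma421Torus
import Literature.MathematicalPhysics.QuantumFieldTheory.BalabanImbrieJaffe1984to88.BIJ85NoZeroModes309Torus

/-!
# `BalabanImbrieJaffe1984to88.BIJ85Prop511GaugeRG` — T. Bałaban, J. Imbrie, A. Jaffe, *Renormalization of the Higgs model: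
minimizers, propagators and the stability of mean field theory*, Commun. Math. Phys. **97** (1985) 299–329
[BalabanImbrieJaffe1985]: **Proposition 5.1.1** (5.1.1)/(5.1.4) p. 313–314 for the SKELETON's decl of record
`BIJ85Sect4Statements.GaugeRG.Prop511` — PROVED for the TORUS MODEL INSTANCE `torusGaugeRG` of r15's abstract carrier `GaugeRG`
(kind «model-instance»; file 4 of row C1.Prop5.1.1: file 1 `…BIJ85Prop511Proof` = the abstract theorem, file 2 `…BIJ85Prop511Torus`
= the torus instance, files 3a/3b `…BIJ85FaddeevPopov518/519` = the printed Faddeev–Popov route)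

statement-level skeleton of published theorems with citation tags; proofs where landed; nothing here is a claim about the Yang–Mills mass gap

PDF held: `paper:balaban1985-cmp97-bij-higgs-minimizers` (journal page = PDF page + 298); pp. 313–315 [PDF 15–17] (render of p. 314
read as an image, see file 1).

CITATION HEADER (lean-in-tree rule).  Phase-2 proof seat p30 (gen 4) of `lit-balaban` (HOME `run/shared/lean/pub/lit-balaban/`, unit
`lit-balaban-p30-g4`); SKELETON row **C1.Prop5.1.1**, whose decl cells are r15's `GaugeRG.lam514` ((5.1.4) as a real definition from
the carrier's contour functionals) and `GaugeRG.Prop511` (`∀ B, Hax B − H B = gradEta (mkGauge (lam514 B))`), «typed p239474».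

THE INSTANCE (every (5.1.1)-relevant field is the genuine torus object of the tree; the printed normalisation `η⁻¹ = L^k` is used as
the lattice factor of `∂`, so that the weights of (5.1.4) are the printed `L^{j−k}` — p08's `BIJ85GaugeFunction5113.eq5113_unit`):
`FieldU` = unit-lattice (level-k) bond fields `PBond P k → ℝ`, `FieldEta` = η-lattice bond fields `VecField P 0 ℝ`, `GaugeEta` = site
functions of `T^{(0)}` with `gradEta = grad (L^k)` and `mkGauge = id`, `Qk = bondAvgIter k` (Q_k), **`Hax B = torusHax w L^k k (Q^{s*}_kB)`**
(p09's (4.1.3) `BIJ85AxialMinimizer413.torusHax` at the axial representative `Q^{s*}_kB` of p30 gen 3's `BIJ85Eq531Inputs.QsstarIter`,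
as in `BIJ85Eq531Proof`), **`H B = Hk (opsV1 P k L^k √w) B`** (p11's (4.4.2) for the V1 operators, read as a bond function), `sigma` =
p30 gen 3's torus σ_k `BIJ85Sigma421Torus.sigmaTorus` ((4.2.1)), `curl` = the unit-lattice curl, `innerP` = Σ_p f(p)g(p), and the
contour functionals of (5.1.4) **`contourTerm B j x = (Q_jH_kB)(Γ_{x_{j+1},x_j})`** = p08's `contour (bondAvgIter j (H B)) (blk j x)`,
**`blockTerm B j x = Σ_{x′∈B(x_{j+1})}(L^{−d}Q_jH_kB)(Γ_{x_{j+1},x′})`** = p08's `blockMean (bondAvgIter j (H B)) (blockOf (blk j x))`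
(`blockMean_eq_blockSum`).  The kernel data of (4.3.3)–(4.3.5) (`distU`, `Ck`, `normCk`: rows C1.Eq4.3.4-4.3.5 are claims by reference
to [6II], not objects constructed in the tree) are PARAMETERS of the instance; (5.1.1) does not involve them.
WHAT IS PROVED (standing range `k ≤ m + K`, `w > 0`, `2 ≤ d` for σ_k):
* `lam514_eq_lamOf` — r15's (5.1.4) for this instance IS p08's (5.1.13) gauge function at `A = H_kB`: `lam514 B = lamOf (L^k) k (H B)`;
* `eq415_torusGaugeRG` — r15's (4.1.5) `GaugeRG.Eq415` HOLDS for the instance (`Q_kH_{k,Ax}B = B`; p09's `torus_eq415` with p33 gen 2's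
  `hD_holds`, and `Q_kQ^{s*}_k = I` of p30 gen 3);
* **`prop511_torusGaugeRG`** — r15's `GaugeRG.Prop511` HOLDS for the instance: `H_{k,Ax}B − H_kB = ∂λ(H_kB)` with λ = (5.1.4), for
  EVERY `B` — file 2's `prop511_torus` at the representative `Q^{s*}_kB`.
Carrier clauses (F6): the standing range of `Setup`; `w > 0`; `2 ≤ d`.  One new definition (the instance); no `def … : Prop`.  Axioms:
the standard three.
-/

namespace Literature.MathematicalPhysics.QuantumFieldTheory.BalabanImbrieJaffe1984to88.BIJ85Prop511GaugeRG

open scoped InnerProductSpace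
open Literature.MathematicalPhysics.QuantumFieldTheory.Balaban1983to89
open LatticeFieldCalculus
open Literature.MathematicalPhysics.QuantumFieldTheory.BalabanImbrieJaffe1984to88.BIJ85Sect4Statements
open Literature.MathematicalPhysics.QuantumFieldTheory.BalabanImbrieJaffe1984to88.BIJ85AxialPropagator411
open Literature.MathematicalPhysics.QuantumFieldTheory.BalabanImbrieJaffe1984to88.BIJ85AxialMinimizer413
open Literature.MathematicalPhysics.QuantumFieldTheory.BalabanImbrieJaffe1984to88.BIJ85LandauMinimizer442
open Literature.MathematicalPhysics.QuantumFieldTheory.BalabanImbrieJaffe1984to88.BIJ85LandauMinimizer442V1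
open Literature.MathematicalPhysics.QuantumFieldTheory.BalabanImbrieJaffe1984to88.BIJ85GaugeFunction5113
open Literature.MathematicalPhysics.QuantumFieldTheory.BalabanImbrieJaffe1984to88.BIJ85Eq5113Proof (deltaAx_lamOf)
open Literature.MathematicalPhysics.QuantumFieldTheory.BalabanImbrieJaffe1984to88.BIJ85Eq531Inputs (QsstarIter
  bondAvgIter_QsstarIter deltaAx_QsstarIter)
open Literature.MathematicalPhysics.QuantumFieldTheory.BalabanImbrieJaffe1984to88.BIJ85Sigma421Torus (toU sigmaTorus)
open Literature.MathematicalPhysics.QuantumFieldTheory.BalabanImbrieJaffe1984to88.BIJ85Prop511Torus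

noncomputable section

/-- **The torus model instance of r15's carrier `GaugeRG` of Sects. 4–5** at scale `k` (volume weight `w = η^d`, printed lattice factor
`η⁻¹ = L^k`): unit-lattice bond fields = `PBond P k → ℝ`, η-lattice bond fields = `VecField P 0 ℝ`, `Q_k = bondAvgIter k`, the axial gauge
minimizer (4.1.3) `H_{k,Ax}B = torusHax w L^k k (Q^{s*}_kB)` (p09, at the axial representative `Q^{s*}_kB`), the Landau gauge minimizer
(4.4.2) `H_kB = Hk (opsV1 P k L^k √w) B` (p11), σ_k = `sigmaTorus` ((4.2.1), p30 gen 3), gauge functions = site functions with `∂ = grad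
L^k`, and the contour functionals of (5.1.4) `(Q_jH_kB)(Γ_{x_{j+1},x_j})`, `Σ_{x′∈B(x_{j+1})}(L^{−d}Q_jH_kB)(Γ_{x_{j+1},x′})` (p08's `contour`,
`blockMean`, point sequence `blk`).  The kernel data of (4.3.3)–(4.3.5) are parameters. [cite: BalabanImbrieJaffe1985, (4.1.3)–(4.1.5) p.310] -/
def torusGaugeRG (P : Params) (hd : 2 ≤ P.d) (k : ℕ) (w : ℝ) (distU Ck : PBond P k → PBond P k → ℝ) (normCk : ℝ) : GaugeRG where
  k := k
  L := P.L
  d := P.d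
  FieldU := PBond P k → ℝ
  FieldEta := VecField P 0 ℝ
  SiteU := Site P k
  SiteEta := Site P 0
  GaugeEta := SiteField P 0 ℝ
  gradEta := grad ((P.L : ℝ) ^ k)
  mkGauge := id
  PlaqU := Plaq P k → ℝ
  innerP := fun f g => ∑ p, f p * g p
  curl := fun B => LatticeFieldCalculus.curl 1 B
  Qk := bondAvgIter k
  Hax := fun B => torusHax w ((P.L : ℝ) ^ k) k (QsstarIter k B)
  H := fun B => WithLp.ofLp (Hk (opsV1 P k ((P.L : ℝ) ^ k) (Real.sqrt w)) B)
  sigma := fun f g => ⟪toU P k f, sigmaTorus (P := P) hd w ((P.L : ℝ) ^ k) k (toU P k g)⟫_ℝ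
  BondU := PBond P k
  distU := distU
  Ck := Ck
  normCk := normCk
  contourTerm := fun B j x =>
    contour (bondAvgIter j (WithLp.ofLp (Hk (opsV1 P k ((P.L : ℝ) ^ k) (Real.sqrt w)) B))) (blk j x)
  blockTerm := fun B j x =>
    blockMean (bondAvgIter j (WithLp.ofLp (Hk (opsV1 P k ((P.L : ℝ) ^ k) (Real.sqrt w)) B))) (blockOf (blk j x))

variable {P : Params}

/-- the printed lattice factor `η⁻¹ = L^k` is non-zero. [folklore] -/
private theorem Lpow_ne_zero (k : ℕ) : ((P.L : ℝ) ^ k) ≠ 0 :=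
  pow_ne_zero k (Nat.cast_ne_zero.mpr P.L_pos.ne')

/-- **(5.1.4) for the instance IS (5.1.13) at `A = H_kB`**: r15's `lam514` (the bracket `(Q_jH_kB)(Γ_{x_{j+1},x_j}) − Σ_{x′∈B(x_{j+1})}
(L^{−d}Q_jH_kB)(Γ_{x_{j+1},x′})` weighted by `L^{j−k}`) equals p08's `lamOf (L^k) k (H_kB)` pointwise (`eq5113_unit`).
[cite: BalabanImbrieJaffe1985, (5.1.4) p.314] -/
theorem lam514_eq_lamOf (hd : 2 ≤ P.d) (k : ℕ) (w : ℝ) (distU Ck : PBond P k → PBond P k → ℝ) (normCk : ℝ)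
    (B : PBond P k → ℝ) (x : Site P 0) :
    (torusGaugeRG P hd k w distU Ck normCk).lam514 B x =
      lamOf ((P.L : ℝ) ^ k) k (WithLp.ofLp (Hk (opsV1 P k ((P.L : ℝ) ^ k) (Real.sqrt w)) B)) x := by
  rw [eq5113_unit]
  rfl

/-- **(4.1.5) `Q_kH_{k,Ax}B = B` HOLDS for the instance** (r15's `GaugeRG.Eq415`): p09's `torus_eq415` (no-zero-modes hypothesis
discharged by p33 gen 2's `BIJ85NoZeroModes309Torus.hD_holds`) and `Q_kQ^{s*}_k = I` (`BIJ85Eq531Inputs.bondAvgIter_QsstarIter`);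
standing range, `w > 0`. [cite: BalabanImbrieJaffe1985, (4.1.5) p.310] -/
theorem eq415_torusGaugeRG (hd : 2 ≤ P.d) {k : ℕ} (hk : k ≤ P.m + P.K) {w : ℝ} (hw : 0 < w)
    (distU Ck : PBond P k → PBond P k → ℝ) (normCk : ℝ) :
    GaugeRG.Eq415 (torusGaugeRG P hd k w distU Ck normCk) := by
  intro B
  show bondAvgIter k (torusHax w ((P.L : ℝ) ^ k) k (QsstarIter k B)) = B
  rw [(torus_eq415 hw _ k (BIJ85NoZeroModes309Torus.hD_holds hk (Lpow_ne_zero k)) _).1, bondAvgIter_QsstarIter hk]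

/-- **Proposition 5.1.1 HOLDS for the torus model instance of `GaugeRG`** ([BalabanImbrieJaffe1985] p. 314, verbatim: *"Proposition
5.1.1. The relation (5.1.1) holds with λ(x) = −Σ_{j=0}^{k−1} L^{j−k}[(Q_jH_kB)(Γ_{x_{j+1},x_j}) − Σ_{x′∈B(x_{j+1})}(L^{−d}Q_jH_kB)(Γ_{x_{j+1},
x′})]. (5.1.4)"*): r15's decl of record `GaugeRG.Prop511` — `∀ B, H_{k,Ax}B − H_kB = ∂λ(B)` with λ = (5.1.4) — for `torusGaugeRG`, in the
standing range `k ≤ m + K`, `w > 0` (`2 ≤ d` enters only σ_k): file 2's `prop511_torus` at the axial representative `Q^{s*}_kB`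
(`Q_kQ^{s*}_kB = B`, `δ_{k,Ax}(Q^{s*}_kB)` — p30 gen 3) and `lam514_eq_lamOf`. [cite: BalabanImbrieJaffe1985, Prop. 5.1.1 p.314] -/
theorem prop511_torusGaugeRG (hd : 2 ≤ P.d) {k : ℕ} (hk : k ≤ P.m + P.K) {w : ℝ} (hw : 0 < w)
    (distU Ck : PBond P k → PBond P k → ℝ) (normCk : ℝ) :
    GaugeRG.Prop511 (torusGaugeRG P hd k w distU Ck normCk) := by
  intro B
  have hlam : (torusGaugeRG P hd k w distU Ck normCk).lam514 B =
      lamOf ((P.L : ℝ) ^ k) k (WithLp.ofLp (Hk (opsV1 P k ((P.L : ℝ) ^ k) (Real.sqrt w)) B)) :=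
    funext (lam514_eq_lamOf hd k w distU Ck normCk B)
  show torusHax w ((P.L : ℝ) ^ k) k (QsstarIter k B) - WithLp.ofLp (Hk (opsV1 P k ((P.L : ℝ) ^ k) (Real.sqrt w)) B) =
    grad ((P.L : ℝ) ^ k) (id ((torusGaugeRG P hd k w distU Ck normCk).lam514 B))
  rw [hlam]
  exact prop511_torus hk (Lpow_ne_zero k) hw (bondAvgIter_QsstarIter hk B) (deltaAx_QsstarIter hk B)

/-- … and the explicit torus form of the conclusion (no carrier): `torusHax w L^k k (Q^{s*}_kB) − H_kB = grad L^k (λ_{(5.1.4)}(B))` with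
r15's `lam514` on the right. [cite: BalabanImbrieJaffe1985, (5.1.1) p.313] -/
theorem eq511_torusGaugeRG (hd : 2 ≤ P.d) {k : ℕ} (hk : k ≤ P.m + P.K) {w : ℝ} (hw : 0 < w)
    (distU Ck : PBond P k → PBond P k → ℝ) (normCk : ℝ) (B : PBond P k → ℝ) :
    torusHax w ((P.L : ℝ) ^ k) k (QsstarIter k B) - WithLp.ofLp (Hk (opsV1 P k ((P.L : ℝ) ^ k) (Real.sqrt w)) B) =
      grad ((P.L : ℝ) ^ k) ((torusGaugeRG P hd k w distU Ck normCk).lam514 B) :=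
  prop511_torusGaugeRG hd hk hw distU Ck normCk B

end

end Literature.MathematicalPhysics.QuantumFieldTheory.BalabanImbrieJaffe1984to88.BIJ85Prop511GaugeRG
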